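import Literature.Computability.Cryptography.ExplicitKWiseHashStringArith
import Literature.Computability.Complexity.HardLangMachine
import Literature.Computability.Complexity.CodeFPArith
import Literature.Computability.Complexity.CodeFPBudgets
import Literature.Computability.Complexity.CodeFPListKit
import Literature.Computability.Complexity.CodeFPStrings
import Literature.Computability.Complexity.CodeFPStringKit
import Literature.Barriers.QuantumAdvantage.TQBFSavitchCode
import HarnessLib

/-!
# The explicit `k`-wise independent hash family is evaluated in polynomial time (`hashLang ∈ P`)

Machine level of `ExplicitKWiseHashFamily.lean` / `ExplicitKWiseHashStringArith.lean`: the keyed Wegman–Carter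
language `hashLang` over `GF(2^{2·3^j}) = 𝔽₂[X]/(X^{2·3^j} + X^{3^j} + 1)` is in `P` (Wegman–Carter, §3: a member
of the family is evaluated with `k` multiplications and additions in the field). The machine is assembled in the
tree's typed polynomial-time algebra `CodeFP` (`Complexity/CodeFP*.lean`: composition, pairs, tests, counted folds
with a polynomially bounded accumulator, `filter`, `any`, `strChunks`, `rawReverse`, numerals; `TQBFRed.strZeros`) from the
modulus-generic `FP` bricks `HardLangM.xorF / clmulF / pmodF / fmulOpF` of `Complexity/HardLangMachine.lean`
(bitwise xor, carry-less product, Horner remainder modulo a monic bit string):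

* `pow3Count B s = #{i < B | 3^i ≤ s}` (`= ⌊log₃ s⌋ + 1`, `pow3Count_eq`), so the field level needs no logarithm
  routine; `modStrOf h` — the modulus string `1 0^{h−1} 1 0^{h−1} 1` from `h = 3^j` (`modStrOf_pow`);
* `hornerStep` (one Horner round `acc ↦ blk + acc·z mod f`, by the bricks; `hornerStep_modStr`), `hornerM` (the
  left fold over the reversed block list, `hornerM_eq`), `hashBitM h k keyL u` and
  `hashBitM_pow : hashBitM (3^j) = hashBitStr j`; **`hashBitC`**: `hashBitM` is computed on codes;
* `hashLangDecideM` (the decision function with the machine's parameter computation: `pow3Count` with budget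
  `|w| + 2`, the power of three capped at `6(|w|+1)` for the unary conversion) and
  `hashLangDecideM_eq : hashLangDecideM = hashLangDecide`; **`hashLangDecideC`**: it is computed on codes;
* **`hashLang_mem_P : hashLang ∈ P`** and **`exists_explicit_kWise_family`**: there are a language `H ∈ P` and a
  polynomial `t` such that for all `k, m` the keyed family `key ↦ {u | ⟨⟨1ᵏ, key⟩, u⟩ ∈ H}` over `t(k+m)` key bits
  is `k`-wise independent on the strings of length `≤ m` — the statement of the stub `stub_explicitKWiseHash` of
  `Summits/QuantumAdvantage/QuantumAdvantage/Cruxes/PromiseTransfer/Lines/birth_PromiseOracleSimulation.lean`.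

Sources: M. N. Wegman, J. L. Carter, JCSS 22 (1981) §3 [cite: WegmanCarter1981, §3]; S. Arora, B. Barak,
Computational Complexity (2009), §1.3 (polynomial time is closed under composition and polynomially bounded loops)
[cite: AroraBarak2009, §1.3]; R. J. McEliece, The Theory of Information and Coding (2002), Ch. 9 §9.1
[cite: Mceliece2002, Ch. 9 §9.1].
-/

noncomputable section

namespace Literature.Computability.Cryptography.ExplicitKWiseHash

open Finset Polynomial Literature.Computability.QuantumComplexity Literature.Computability.Complexity
  Literature.Computability.Complexity.GF2Str Literature.Computability.Complexity.HardLangM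
  Literature.Computability.Complexity.CodeFP Brick

/-! ### The field level without logarithms -/

/-- `pow3Count B s = #{i < B | 3^i ≤ s}`. [cite: AroraBarak2009, §1.3] -/
def pow3Count (B s : ℕ) : ℕ := ((List.range B).filter fun i => decide (3 ^ i ≤ s)).length

/-- `pow3Count B s = ⌊log₃ s⌋ + 1` once `B > ⌊log₃ s⌋` (`s ≥ 1`). [cite: AroraBarak2009, §1.3] -/
theorem pow3Count_eq {B s : ℕ} (hs : s ≠ 0) (hB : Nat.log 3 s + 1 ≤ B) : pow3Count B s = Nat.log 3 s + 1 := by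
  rw [pow3Count]
  have key : ∀ i, (decide (3 ^ i ≤ s) = true) ↔ i ≤ Nat.log 3 s := fun i => by
    rw [decide_eq_true_eq]
    exact (Nat.le_log_iff_pow_le (by norm_num) hs).symm
  obtain ⟨d, rfl⟩ := Nat.exists_eq_add_of_le hB
  rw [List.range_add, List.filter_append,
    List.filter_eq_self.2 (fun a ha => (key a).2 (by have := List.mem_range.1 ha; omega)),
    List.filter_eq_nil_iff.2 (fun a ha => by
      obtain ⟨i, -, rfl⟩ := List.mem_map.1 ha
      rw [key]; omega),
    List.append_nil, List.length_range]

/-- `3 ^ pow3Count B (k+m+1) = 3 ^ level k m` for a large enough budget. [cite: AroraBarak2009, §1.3] -/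
theorem pow_pow3Count (k m B : ℕ) (hB : k + m + 2 ≤ B) : 3 ^ pow3Count B (k + m + 1) = 3 ^ level k m := by
  rw [pow3Count_eq (by omega) ?_, level]
  have h1 : Nat.log 3 (k + m + 1) < k + m + 1 := Nat.log_lt_self 3 (by omega)
  omega

/-! ### The modulus string from the power of three -/

/-- The modulus string `1 0^{h−1} 1 0^{h−1} 1` built from `h` (`= 3^j`). [cite: Mceliece2002, Ch. 9 §9.1] -/
def modStrOf (h : ℕ) : List Bool :=
  true :: (List.replicate (h - 1) false ++ true :: (List.replicate (h - 1) false ++ [true]))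

/-- Entries of `modStrOf h` (`h ≥ 1`): set exactly at `0`, `h`, `2h`. [cite: Mceliece2002, Ch. 9 §9.1] -/
theorem getD_modStrOf {h : ℕ} (hh : 1 ≤ h) (i : ℕ) :
    (modStrOf h).getD i false = decide (i = 2 * h ∨ i = h ∨ i = 0) := by
  rw [modStrOf]
  rcases Nat.eq_zero_or_pos i with rfl | hi
  · simp
  obtain ⟨i, rfl⟩ : ∃ i', i = i' + 1 := ⟨i - 1, by omega⟩
  rw [List.getD_cons_succ]
  by_cases h1 : i < h - 1
  · rw [List.getD_append _ _ _ _ (by simpa using h1), List.getD_replicate (h := h1)]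
    symm; rw [decide_eq_false_iff_not]; omega
  · rw [List.getD_append_right _ _ _ _ (by simpa using not_lt.1 h1), List.length_replicate]
    rcases Nat.eq_zero_or_pos (i - (h - 1)) with h0 | hpos
    · rw [h0, List.getD_cons_zero]
      symm; rw [decide_eq_true_iff]; omega
    obtain ⟨i', hi'⟩ : ∃ i', i - (h - 1) = i' + 1 := ⟨i - (h - 1) - 1, by omega⟩
    rw [hi', List.getD_cons_succ]
    by_cases h2 : i' < h - 1
    · rw [List.getD_append _ _ _ _ (by simpa using h2), List.getD_replicate (h := h2)]
      symm; rw [decide_eq_false_iff_not]; omega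
    · rw [List.getD_append_right _ _ _ _ (by simpa using not_lt.1 h2), List.length_replicate]
      rcases Nat.eq_zero_or_pos (i' - (h - 1)) with h0 | hpos'
      · rw [h0, List.getD_cons_zero]
        symm; rw [decide_eq_true_iff]; omega
      · rw [List.getD_eq_default _ _ (by simp; omega)]
        symm; rw [decide_eq_false_iff_not]; omega

/-- `modStrOf (3^j)` is the modulus string `modStr j`. [cite: Mceliece2002, Ch. 9 §9.1] -/
theorem modStrOf_pow (j : ℕ) : modStrOf (3 ^ j) = modStr j := by
  have h3 : 1 ≤ 3 ^ j := Nat.one_le_pow _ _ (by norm_num)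
  apply List.ext_getElem
  · rw [(modStr_top j).1, dim_eq, modStrOf]
    simp only [List.length_cons, List.length_append, List.length_replicate, List.length_nil]
    omega
  · intro i h1 h2
    have e1 := List.getD_eq_getElem (modStrOf (3 ^ j)) false h1
    have e2 := List.getD_eq_getElem (modStr j) false h2
    rw [← e1, ← e2, getD_modStrOf h3, getD_modStr, coeff_modulus]
    by_cases h : i = 2 * 3 ^ j ∨ i = 3 ^ j ∨ i = 0
    · rw [decide_eq_true h, if_pos h]; rfl
    · rw [decide_eq_false h, if_neg h]; rfl

/-! ### One Horner round, by the bricks -/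

/-- **One Horner round** on `((z, f), (blk, acc))`: `blk + (acc · z mod f)`, literally the value of the brick
`xorF ⟨blk, fmulOpF ⟨acc, ⟨z, f⟩⟩⟩`. [cite: WegmanCarter1981, §3] -/
def hornerStep (t : (List Bool × List Bool) × (List Bool × List Bool)) : List Bool :=
  xorStr t.2.1 (fmulOpF (boolPair t.2.2 (boolPair t.1.1 t.1.2)))

/-- `hornerStep` is computed on codes. [cite: AroraBarak2009, §1.3] -/
theorem hornerStepC : CodeFP (pairE (pairE strE strE) (pairE strE strE)) strE hornerStep :=
  ⟨xorF ∘ fanoutFn (fstF ∘ sndF) (fmulOpF ∘ fanoutFn (sndF ∘ sndF) fstF),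
    comp_mem_FP xorF_mem_FP (fanoutFn_mem_FP (comp_mem_FP fstF_mem_FP sndF_mem_FP)
      (comp_mem_FP fmulOpF_mem_FP (fanoutFn_mem_FP (comp_mem_FP sndF_mem_FP sndF_mem_FP) fstF_mem_FP))),
    fun t => by
      obtain ⟨⟨z, f⟩, ⟨blk, acc⟩⟩ := t
      simp [hornerStep, fanoutFn_apply, xorF_apply, strE]⟩

/-- The multiplication brick with the modulus `modStr j` multiplies in `BinField j` (on ANY bit strings:
`fmulOpF ⟨a, ⟨b, modStr j⟩⟩ = fmulStr j a b`). [cite: Mceliece2002, Ch. 9 §9.1] -/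
theorem fmulOpF_modStr (j : ℕ) (a b : List Bool) :
    fmulOpF (boolPair a (boolPair b (modStr j))) = fmulStr j a b := by
  simp only [fmulOpF, Function.comp_apply, fanoutFn_apply, fstF_boolPair, sndF_boolPair, clmulF_apply]
  rw [pmodF_apply _ _ (modStr_top j).1, fmulStr]
  exact pmodStr_congr (modStr_top j).1 (modStr_top j).2 (by rw [polyOfBits_clmulFold, polyOfBits_clmul])

/-- One Horner round with the modulus `modStr j`. [cite: WegmanCarter1981, §3] -/
theorem hornerStep_modStr (j : ℕ) (z blk acc : List Bool) :
    hornerStep ((z, modStr j), (blk, acc)) = xorStr blk (fmulStr j acc z) := by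
  rw [hornerStep, fmulOpF_modStr]

/-- A Horner round is short: `≤ max |blk| (|f| − 1)` symbols. [cite: AroraBarak2009, §1.3] -/
theorem length_hornerStep_le (z f blk acc : List Bool) :
    (hornerStep ((z, f), (blk, acc))).length ≤ max blk.length (f.length - 1) := by
  rw [hornerStep, length_xorStr]
  refine max_le_max le_rfl ?_
  simp only [fmulOpF, Function.comp_apply, fanoutFn_apply, fstF_boolPair, sndF_boolPair]
  exact length_pmodF_le _ _

/-! ### The Horner fold and the hash bit -/

/-- **The machine's Horner evaluation**: left fold of `hornerStep` over the (reversed) block list from `0^{|z|}`.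
[cite: WegmanCarter1981, §3] -/
def hornerM (z f : List Bool) (blocksRev : List (List Bool)) : List Bool :=
  blocksRev.foldl (fun acc blk => hornerStep ((z, f), (blk, acc))) (List.replicate z.length false)

/-- The machine's Horner evaluation over the reversed blocks is `hornerStr`. [cite: WegmanCarter1981, §3] -/
theorem hornerM_eq (j : ℕ) {z : List Bool} (hz : z.length = dim j) (cs : List (List Bool)) :
    hornerM z (modStr j) cs.reverse = hornerStr j z cs := by
  rw [hornerM, hornerStr, List.foldl_reverse, hz]
  congr 1
  funext c acc
  exact hornerStep_modStr j z c acc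

/-- The accumulator of the Horner fold stays below any bound on the blocks, `|f| − 1` and the start.
[cite: AroraBarak2009, §1.3] -/
theorem length_hornerFold_le (z f : List Bool) {M : ℕ} (hf : f.length - 1 ≤ M) :
    ∀ (l : List (List Bool)) (acc : List Bool), (∀ b ∈ l, b.length ≤ M) → acc.length ≤ M →
      (l.foldl (fun acc blk => hornerStep ((z, f), (blk, acc))) acc).length ≤ M
  | [], acc, _, hacc => by simpa using hacc
  | b :: l, acc, hl, _ => by
    rw [List.foldl_cons]
    exact length_hornerFold_le z f hf l _ (fun b' hb' => hl b' (List.mem_cons_of_mem _ hb'))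
      ((length_hornerStep_le z f b acc).trans (max_le (hl b List.mem_cons_self) hf))

/-- **The machine's hash bit** from the power of three `h` (`= 3^j`), the unary `k`, the key string and the point:
blocks of `2h` key bits, reversed, Horner at the padded point with modulus `modStrOf h`, bit `0`.
[cite: WegmanCarter1981, §3] -/
def hashBitM (h k : ℕ) (keyL u : List Bool) : Bool :=
  (hornerM (padStr (2 * h) u) (modStrOf h)
    ((List.range k).map fun t => (keyL.drop (t * (2 * h))).take (2 * h)).reverse).getD 0 false

/-- **At `h = 3^j` the machine's hash bit is `hashBitStr j`.** [cite: WegmanCarter1981, §3] -/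
theorem hashBitM_pow (j k : ℕ) (keyL u : List Bool) : hashBitM (3 ^ j) k keyL u = hashBitStr j k keyL u := by
  rw [hashBitM, hashBitStr, modStrOf_pow, ← dim_eq, hornerM_eq j (length_padStr _ _)]
  congr 3
  funext t
  rw [mul_comm]

/-- The input of the hash-bit machine: `((h, k), (keyL, u))` coded `⟨⟨1ʰ, 1ᵏ⟩, ⟨keyL, u⟩⟩`. [cite: AroraBarak2009, §1.3] -/
abbrev bitInE : (ℕ × ℕ) × (List Bool × List Bool) → List Bool := pairE (pairE unE unE) (pairE strE strE)

/-- `1ⁿ = replicate n true`. [folklore] -/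
private theorem unE_eq_replicate (n : ℕ) : unE n = List.replicate n true := by
  rw [unE_eq_ones]

/-- Unary predecessor: `1ʰ ↦ 1^{h−1}`. [cite: AroraBarak2009, §1.3] -/
theorem unPredC : CodeFP unE unE (fun h => h - 1) :=
  (strDrop.comp ((const unE 1).pair (strOfUn.comp (CodeFP.id unE)))).recodeOut fun h => by
    simp only [id, strE, unE_eq_replicate, List.drop_replicate]

/-- The modulus string is computed from `1ʰ`. [cite: AroraBarak2009, §1.3] -/
theorem modStrOfC : CodeFP unE strE modStrOf :=
  (consBit.comp ((const unE true).pair (strAppend.comp ((Literature.Barriers.QuantumAdvantage.TQBFRed.strZeros.comp unPredC).pair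
    (consBit.comp ((const unE true).pair (strAppend.comp ((Literature.Barriers.QuantumAdvantage.TQBFRed.strZeros.comp unPredC).pair
      (const unE [true]))))))))).congr fun _ => rfl

/-- The padded point `padStr (2h) u` is computed from `(1ʰ, u)`. [cite: AroraBarak2009, §1.3] -/
theorem padStrC : CodeFP (pairE unE strE) strE (fun p => padStr (2 * p.1) p.2) :=
  (strTake.comp ((((unMulConst 2).comp (fst unE strE))).pair (strAppend.comp ((snd unE strE).pair
    (consBit.comp ((const _ true).pair (Literature.Barriers.QuantumAdvantage.TQBFRed.strZeros.comp ((unMulConst 2).comp (fst unE strE))))))))).congr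
    fun _ => rfl

/-- The Horner accumulator is bounded by the length of the fold's input code. [cite: AroraBarak2009, §1.3] -/
private theorem hornerM_bound (z f : List Bool) (l₁ l₂ : List (List Bool)) :
    (l₁.foldl (fun acc blk => hornerStep ((z, f), (blk, acc))) (List.replicate z.length false)).length ≤
      2 * (2 * z.length + 2 + f.length) + 2 + (rawE strE (l₁ ++ l₂)).length := by
  refine length_hornerFold_le z f (by omega) l₁ _ (fun b hb => ?_) (by simp only [List.length_replicate]; omega)
  have hb' := length_item_le_length_rawE strE (List.mem_append_left l₂ hb)
  change 2 * b.length + 2 ≤ _ at hb'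
  omega

/-- **The Horner fold is computed on codes** (`CodeFP.foldl`, accumulator bounded by the input length).
[cite: AroraBarak2009, §1.3] -/
theorem hornerMC : CodeFP (pairE (pairE strE strE) (rawE strE)) strE (fun p => hornerM p.1.1 p.1.2 p.2) := by
  have hstep : CodeFP (pairE (pairE strE strE) (pairE strE strE)) strE
      (fun t => hornerStep (t.1, (t.2.1, t.2.2))) := hornerStepC.congr fun _ => rfl
  have hinit : CodeFP (pairE strE strE) strE (fun σ => List.replicate σ.1.length false) :=
    Literature.Barriers.QuantumAdvantage.TQBFRed.strZeros.comp (strLength.comp (fst strE strE))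
  have h := CodeFP.foldl (σ := List Bool × List Bool) (α := List Bool) (β := List Bool)
    (eσ := pairE strE strE) (eα := strE) (eβ := strE)
    (step := fun σ blk acc => hornerStep (σ, (blk, acc))) (init := fun σ => List.replicate σ.1.length false)
    hstep hinit X (fun σ l₁ l₂ => by
      obtain ⟨z, f⟩ := σ
      rw [eval_X, pairE_apply, pairE_apply, length_boolPair, length_boolPair]
      exact hornerM_bound z f l₁ l₂)
  exact h.congr fun _ => rfl

/-- **The machine's hash bit is computed on codes.** [cite: WegmanCarter1981, §3] [cite: AroraBarak2009, §1.3] -/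
theorem hashBitC : CodeFP bitInE bitE (fun q => hashBitM q.1.1 q.1.2 q.2.1 q.2.2) := by
  have hH : CodeFP bitInE unE (fun q => q.1.1) := (fst _ _).fst'
  have hK : CodeFP bitInE unE (fun q => q.1.2) := (fst _ _).snd'
  have hKey : CodeFP bitInE strE (fun q => q.2.1) := (snd _ _).fst'
  have hU : CodeFP bitInE strE (fun q => q.2.2) := (snd _ _).snd'
  have hDim : CodeFP bitInE unE (fun q => 2 * q.1.1) := (unMulConst 2).comp hH
  have hZ : CodeFP bitInE strE (fun q => padStr (2 * q.1.1) q.2.2) := padStrC.comp (hH.pair hU)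
  have hMod : CodeFP bitInE strE (fun q => modStrOf q.1.1) := modStrOfC.comp hH
  have hBlocks : CodeFP bitInE (rawE strE)
      (fun q => (List.range q.1.2).map fun t => (q.2.1.drop (t * (2 * q.1.1))).take (2 * q.1.1)) :=
    strChunks.comp (hK.pair (hDim.pair hKey))
  have hRev : CodeFP bitInE (rawE strE)
      (fun q => ((List.range q.1.2).map fun t => (q.2.1.drop (t * (2 * q.1.1))).take (2 * q.1.1)).reverse) :=
    (rawReverse strE).comp hBlocks
  have hHorner := hornerMC.comp ((hZ.pair hMod).pair hRev)
  exact (strGetD.comp ((const bitInE 0).pair hHorner)).congr fun _ => rfl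

/-! ### The decision machine of the keyed language -/

/-- **The machine's decision function**: as `hashLangDecide`, with the field parameter computed as
`min (3 ^ pow3Count (|w|+2) (k+m+1)) (6(|w|+1))` (the count needs no logarithm routine, the cap makes the unary
conversion polynomial; both are exact on the promise `k + m + 1 ≤ |w| + 1`). [cite: WegmanCarter1981, §3] -/
def hashLangDecideM (w : List Bool) : Bool :=
  let a := (boolUnpair w).1
  let u := (boolUnpair w).2
  let ks := (boolUnpair a).1
  let keyL := (boolUnpair a).2
  decide (w = boolPair (boolPair ks keyL) u) && decide (ks = List.replicate ks.length true) &&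
    (List.range (keyL.length + 1)).any fun m =>
      decide (keyPoly.eval (ks.length + m) = keyL.length) &&
        hashBitM (min (3 ^ pow3Count (w.length + 2) (ks.length + m + 1)) (6 * (w.length + 1))) ks.length keyL u

/-- `any` over a list depends only on the values at its members. [folklore] -/
private theorem any_congr_mem {α : Type*} {l : List α} {f g : α → Bool} (h : ∀ a ∈ l, f a = g a) :
    l.any f = l.any g := by
  induction l with
  | nil => rfl
  | cons a l ih =>
    rw [List.any_cons, List.any_cons, h a List.mem_cons_self, ih fun b hb => h b (List.mem_cons_of_mem a hb)]

/-- The parts of `w = ⟨⟨ks, keyL⟩, u⟩` are short: `|ks| + |keyL| ≤ |w|`. [folklore] -/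
private theorem parts_le (w : List Bool) :
    (boolUnpair (boolUnpair w).1).1.length + (boolUnpair (boolUnpair w).1).2.length ≤ w.length := by
  have h1 := length_boolUnpair_parts_le w
  have h2 := length_boolUnpair_parts_le (boolUnpair w).1
  omega

/-- **The machine's decision function is `hashLangDecide`.** [cite: WegmanCarter1981, §3] -/
theorem hashLangDecideM_eq (w : List Bool) : hashLangDecideM w = hashLangDecide w := by
  simp only [hashLangDecideM, hashLangDecide]
  congr 1
  refine any_congr_mem fun m hm => ?_
  rw [List.mem_range] at hm
  congr 1
  have hparts := parts_le w
  set k := (boolUnpair (boolUnpair w).1).1.length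
  have hpow : 3 ^ pow3Count (w.length + 2) (k + m + 1) = 3 ^ level k m := pow_pow3Count k m _ (by omega)
  have hcap : 3 ^ level k m ≤ 6 * (w.length + 1) := by
    have := dim_level_le k m
    rw [dim_eq] at this
    omega
  rw [hpow, min_eq_left hcap, hashBitM_pow, stdHashBitStr]

/-- `strE` is injective. [folklore] -/
private theorem strE_injective : Function.Injective strE := fun _ _ h => h

/-- **The machine's decision function is computed on codes.** [cite: WegmanCarter1981, §3] [cite: AroraBarak2009, §1.3] -/
theorem hashLangDecideMC : CodeFP strE bitE hashLangDecideM := by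
  -- the four fields of `w`
  have cW : CodeFP strE strE (fun w => w) := CodeFP.id strE
  have cA : CodeFP strE strE (fun w => (boolUnpair w).1) := ⟨fstF, fstF_mem_FP, fun _ => rfl⟩
  have cU : CodeFP strE strE (fun w => (boolUnpair w).2) := ⟨sndF, sndF_mem_FP, fun _ => rfl⟩
  have cFst : CodeFP strE strE (fun a => (boolUnpair a).1) := ⟨fstF, fstF_mem_FP, fun _ => rfl⟩
  have cSnd : CodeFP strE strE (fun a => (boolUnpair a).2) := ⟨sndF, sndF_mem_FP, fun _ => rfl⟩
  have cKs : CodeFP strE strE (fun w => (boolUnpair (boolUnpair w).1).1) := cFst.comp cA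
  have cKeyL : CodeFP strE strE (fun w => (boolUnpair (boolUnpair w).1).2) := cSnd.comp cA
  -- check 1: re-encode and compare
  have cRe : CodeFP strE strE
      (fun w => boolPair (boolPair (boolUnpair (boolUnpair w).1).1 (boolUnpair (boolUnpair w).1).2) (boolUnpair w).2) :=
    ((cKs.pair cKeyL).pair cU).recodeOut fun _ => rfl
  have c1 : CodeFP strE bitE (fun w => decide (w =
      boolPair (boolPair (boolUnpair (boolUnpair w).1).1 (boolUnpair (boolUnpair w).1).2) (boolUnpair w).2)) :=
    (CodeFP.eq strE_injective).comp (cW.pair cRe)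
  -- check 2: the unary field is all ones
  have c2 : CodeFP strE bitE (fun w => decide ((boolUnpair (boolUnpair w).1).1 =
      List.replicate (boolUnpair (boolUnpair w).1).1.length true)) :=
    ((CodeFP.eq strE_injective).comp (cKs.pair (strOfUn.comp (strLength.comp cKs)))).congr fun w => by
      simp only [unE_eq_replicate]
  -- the predicate on `(w, m)`
  have dW : CodeFP (pairE strE natE) strE (fun q => q.1) := fst _ _
  have dM : CodeFP (pairE strE natE) natE (fun q => q.2) := snd _ _
  have dKs := cKs.comp dW
  have dKeyL := cKeyL.comp dW
  have dU := cU.comp dW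
  have dKnat : CodeFP (pairE strE natE) natE (fun q => (boolUnpair (boolUnpair q.1).1).1.length) :=
    strNatLength.comp dKs
  have dKun : CodeFP (pairE strE natE) unE (fun q => (boolUnpair (boolUnpair q.1).1).1.length) :=
    strLength.comp dKs
  have dS : CodeFP (pairE strE natE) natE (fun q => (boolUnpair (boolUnpair q.1).1).1.length + q.2 + 1) :=
    natAdd.comp ((natAdd.comp (dKnat.pair dM)).pair (const _ 1))
  have dLen : CodeFP (pairE strE natE) bitE (fun q => decide (keyPoly.eval ((boolUnpair (boolUnpair q.1).1).1.length + q.2) =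
      (boolUnpair (boolUnpair q.1).1).2.length)) :=
    (natEq.comp ((natMul.comp ((const _ 6).pair (natMul.comp (dS.pair dS)))).pair (strNatLength.comp dKeyL))).congr
      fun q => by simp only [keyPoly_eval, pow_two]
  -- budget `B = |w| + 2` (unary), count, power of three, cap, unary field parameter
  have dB : CodeFP (pairE strE natE) unE (fun q => q.1.length + 2) :=
    (unSucc.comp (unSucc.comp (strLength.comp dW))).congr fun _ => rfl
  have dPred : CodeFP (pairE (pairE unE natE) natE) bitE (fun r => decide (3 ^ min r.2 r.1.1 ≤ r.1.2)) :=
    natLe.comp ((natPow.comp ((const _ 3).pair (unOfNatMin.comp ((fst _ _).fst'.pair (snd _ _))))).pair (fst _ _).snd')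
  have dFilt : CodeFP (pairE strE natE) (rawE natE)
      (fun q => (List.range (q.1.length + 2)).filter fun i =>
        decide (3 ^ i ≤ (boolUnpair (boolUnpair q.1).1).1.length + q.2 + 1)) :=
    ((CodeFP.filter dPred).comp ((dB.pair dS).pair (urange.comp dB))).congr fun q => by
      refine List.filter_congr fun i hi => ?_
      rw [List.mem_range] at hi
      simp only [min_eq_left hi.le]
  have dT : CodeFP (pairE strE natE) unE
      (fun q => pow3Count (q.1.length + 2) ((boolUnpair (boolUnpair q.1).1).1.length + q.2 + 1)) :=
    ((ulength natE).comp dFilt).congr fun _ => rfl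
  have dHnat : CodeFP (pairE strE natE) natE
      (fun q => 3 ^ pow3Count (q.1.length + 2) ((boolUnpair (boolUnpair q.1).1).1.length + q.2 + 1)) :=
    natPow.comp ((const _ 3).pair dT)
  have dCap : CodeFP (pairE strE natE) unE (fun q => 6 * (q.1.length + 1)) :=
    (unMulConst 6).comp (unSucc.comp (strLength.comp dW))
  have dH : CodeFP (pairE strE natE) unE (fun q =>
      min (3 ^ pow3Count (q.1.length + 2) ((boolUnpair (boolUnpair q.1).1).1.length + q.2 + 1)) (6 * (q.1.length + 1))) :=
    unOfNatMin.comp (dCap.pair dHnat)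
  have dBit := hashBitC.comp ((dH.pair dKun).pair (dKeyL.pair dU))
  have dP := dLen.and dBit
  -- the `any` over `m ≤ |keyL|`
  have cMs : CodeFP strE (rawE natE) (fun w => List.range ((boolUnpair (boolUnpair w).1).2.length + 1)) :=
    urange.comp (unSucc.comp (strLength.comp cKeyL))
  have c3 := (CodeFP.any dP).comp (cW.pair cMs)
  exact ((c1.and c2).and c3).congr fun _ => rfl

/-- **The keyed hash language is decided on codes.** [cite: WegmanCarter1981, §3] [cite: AroraBarak2009, §1.3] -/
theorem hashLangDecideC : CodeFP strE bitE hashLangDecide :=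
  hashLangDecideMC.congr hashLangDecideM_eq

/-- **`hashLang ∈ P`.** [cite: WegmanCarter1981, §3] [cite: AroraBarak2009, §1.3] -/
theorem hashLang_mem_P : hashLang ∈ Classes.P := by
  classical
  obtain ⟨F, hF, hFw⟩ := hashLangDecideC
  refine mem_P_of_mem_FP hF _ fun w => ⟨fun hw => ?_, fun hw => ?_⟩
  · rw [show F w = bitE (hashLangDecide w) from hFw w, hashLangDecide_eq, decide_eq_true hw]; rfl
  · rw [show F w = bitE (hashLangDecide w) from hFw w, hashLangDecide_eq, decide_eq_false hw]; rfl

/-- **Explicit `k`-wise independent hashing in `P`, keyed form**: a language `H ∈ P` and a key-length polynomial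
`t` such that for all `k, m` the family `key ↦ {u | ⟨⟨1ᵏ, key⟩, u⟩ ∈ H}` over uniform keys of `t(k+m)` bits is
`k`-wise independent on the strings of length `≤ m` (the statement `ExplicitKWiseHash` of the quantum-advantage
crux `PromiseTransfer`, with `H = hashLang`, `t = 6(X+1)²`). [cite: WegmanCarter1981, §3] [cite: AlonBabaiItai1986, §2] -/
theorem exists_explicit_kWise_family :
    ∃ H ∈ Classes.P, ∃ t : Polynomial ℕ, ∀ k m : ℕ,
      IsKWiseIndepFamily
        (fun key : Fin (t.eval (k + m)) → Bool =>
          {u : List Bool | boolPair (boolPair (List.replicate k true) (List.ofFn key)) u ∈ H})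
        (shortStrings (m + 1)) k :=
  exists_explicit_family_of_mem_P hashLang_mem_P

end Literature.Computability.Cryptography.ExplicitKWiseHash

end
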